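import Literature.NumberTheory.EllipticCurves.Rank1Residual.Predicates
import Literature.NumberTheory.EllipticCurves.Rank1Residual.X9ImageShape
import Literature.NumberTheory.EllipticCurves.SemistableModPImageIrreducibleProofs
import Literature.NumberTheory.EllipticCurves.SupersingularIrreducibleProofs
import HarnessLib

/-!
# BSD rank-≤1 residual cell: at a good SUPERSINGULAR prime `p ≠ 2`, a non-surjective `ρ̄_{E,p}`
# has image in the normaliser of a NON-SPLIT Cartan subgroup (Serre 1972, §1.11 Prop. 12 + §2)

HONEST FRAMING (cell `b2b-bsdres-*`, run/shared/lean/b2b/bsd-rank1-residual/, verbatim): the goal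
of the cell is to DELETE the COMBINATION-SHAPED residual classes for ALL analytic-rank `≤ 1` elliptic
curves over `ℚ` — "full BSD formula for every rank `≤ 1` curve in class C" assembled STRICTLY from
published theorems — so that the rank-`≤ 1` remainder becomes exactly the CONSTRUCTION-SHAPED
classes, which are TYPED (missing-input Props), NOT attempted; this is not "finishing BSD".
Prove what is provable now; shrink each hard class to its core with data; no claim beyond stated
classes.  Research routes; census output = EVIDENCE, never a Literature fact.  Unit
`b2b-bsdres-n1011-p04-g2` (team n1011, O8 image strand, row T-O8c).  THEOREMS ONLY (no definition,
no named fact, no instance); a TOOL file about the Galois image at a good supersingular prime —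
the STRUCTURE of the image, no closure value, no class theorem, no label moves.

## What this file does

The tree already holds the two other local types: at a MULTIPLICATIVE `p ≥ 7` an irreducible
non-surjective `ρ̄_{E,p}` normalises a SPLIT Cartan subgroup (x11c,
`GaloisImage/MultiplicativeCartanNormalizer.lean`), and at a good ORDINARY `p ≥ 7` likewise (x9,
`Literature/…/Rank1Residual/X9ImageShape.lean`); in both the image is never inside a non-split
Cartan normaliser for `p ≥ 5`.  This file is the third local type, good SUPERSINGULAR reduction,
where the roles of "split" and "non-split" are exchanged and NO restriction `p ≠ 5` / `p ≥ 7` is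
needed (Serre's Prop. 17 for a non-split Cartan subgroup holds at every odd `p`):

* `isCyclic_and_card_inertia_map_of_goodSS` — **Serre §1.11 Prop. 12, frame-free**: at a good
  supersingular `p ≠ 2` (`GoodSS W p`: `p ∤ N`, `p ∣ a_p`, on a global minimal model) the image of
  the inertia group `I_𝔏` of EVERY prime `𝔏 ∣ p` of `\bar ℤ` in `Aut(E[p])` is cyclic of order
  `p² - 1` — the supersingular branch of the tree's `inertia_shape_of_isSemistable`, with
  semistability replaced by the single local hypothesis `GoodSS W p` (tame inertia acts through the
  fundamental character of level `2`: `isCyclic_and_card_inertia_map_of_dvd_frobeniusTrace` + the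
  tame Kummer input `exists_mem_inertia_smul_eq_mul_of_pow_eq`, transported to every `𝔏` by
  conjugation `isCyclic_and_card_map_inertia_smul`).
* `exists_unitGroup_eq_inertia_image_of_goodSS` / `exists_unitGroup_le_image_of_goodSS` — in a
  frame `Φ : Aut(E[p]) ≃ GL₂(𝔽_p)` the inertia image IS a non-split Cartan subgroup `kˣ`
  (`k ⊆ M₂(𝔽_p)` a field, `[k : 𝔽_p] = 2`; Prop. 12 c), `exists_isField_eq_unitGroup_map_of_isCyclic`),
  so `G = Φ(ρ̄(Γ_ℚ)) ⊇ kˣ`.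
* `E[p]` is irreducible (Serre Prop. 12; tree theorem `hasIrreducibleModPGaloisRep_of_dvd_frobeniusTrace`,
  packaged as `Partition.irr_of_goodSS` in `Theorems/Rank1ResidualPartitionBinding.lean` — used here
  as a proof term, not re-declared); `not_dvd_card_image_of_goodSS_of_not_surj` — hence `p ∤ #G`
  when `ρ̄` is not onto (Prop. 15).
* `exists_le_normalizer_unitGroup_of_goodSS_of_not_surj` — **MAIN: `GoodSS ∧ ¬Surj` at `p ≠ 2`
  ⟹ `kˣ ≤ G ≤ N(kˣ)` and `G ⊄ kˣ`** for the inertia non-split Cartan subgroup `kˣ` (Prop. 17,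
  non-split case, any odd `p`: `borel_or_normalizer_of_unitGroup_le`; Borel excluded by `irr`;
  `G ⊆ C` excluded by complex conjugation; then Prop. 14 `prop14_unitGroup` (`p ≥ 3`) identifies the
  normalised Cartan subgroup with `kˣ`).  The row's literal shape `GoodSS → 5 ≤ p → ¬Surj → G ≤ N(C_ns)`
  is `exists_le_normalizer_unitGroup_of_goodSS_of_five_le`; the dichotomy "onto or non-split
  dihedral" is `surj_or_exists_le_normalizer_unitGroup_of_goodSS`.
* `not_le_normalizer_splitCartan_of_goodSS` — **at a good supersingular `p ≠ 2` the image is NEVER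
  inside the normaliser of a split Cartan subgroup** (no hypothesis on the image: Prop. 14 would make
  the split Cartan subgroup equal to `kˣ`, absurd by x9's `unitGroup_ne_splitCartan`).  So
  Bilu–Parent–Rebolledo / BDMTV (split Cartan) say nothing here, Sutherland's types `pNs` never occur
  at a supersingular `p`, and the exceptional types `𝔄₄/𝔖₄/𝔄₅` do not occur at `p ≥ 5` either
  (the image is dihedral of NON-SPLIT type: Serre uniformity territory, `X_ns⁺(p)`).
* `galoisRepTorsion_eq_one_of_mem_inertia_of_good_or_mult` — per-place form of Serre's (ii): with
  `p ∤ #ρ̄(Γ_ℚ)`, `ρ̄` kills the inertia of every prime above a place `v ∤ p` of good OR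
  multiplicative reduction (the tree's `…_of_isSemistable` assumed global semistability).
* `exists_index_two_subgroup_of_goodSS_of_not_surj` — the quadratic character: `U = ρ̄⁻¹(Φ⁻¹(kˣ))`
  is open of index `2` in `Γ_ℚ` and contains the inertia groups above `p` (the inertia image IS
  `kˣ`: the quadratic field `M` of `U` is UNRAMIFIED AT `p`) and above every place of good or
  multiplicative reduction — `M` ramifies only at ADDITIVE primes of `E` (for `E` semistable this is
  Serre's contradiction, Prop. 21; class X6 has `irr ⇒ surj`).
* `exists_frame_le_normalizer_unitGroup_of_goodSS_of_not_surj` — frame-free summary.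

What is NOT claimed: no bound on `p` (that is Serre's uniformity question for `X_ns⁺(p)`:
Balakrishnan–Dogra–Müller–Tuitman–Vonk at `p = 13, 17`, Furio–Lombardo 2025 for `p > 37`, all
NAMED facts in `Literature/NumberTheory/SerreUniformity/Statement.lean`, none used here); no class
theorem; nothing at `p = 2`; no statement about the additive (O8) rows themselves — the transport to
the potentially-good-supersingular twist rows of O8 (`e = 2`) is a sequel.  Census shadow (T-O8,
`cells/n1011/O8-SUBPARTITION.md`): the O8 images `5Nn` ×73, `7Nn` ×11 (and X7's `pNn` rows) are the
rows this structure theorem speaks to.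

## References

* [Serre1972] J.-P. Serre, *Propriétés galoisiennes des points d'ordre fini des courbes
  elliptiques*, Invent. Math. 15 (1972) 259–331: §1.11 Prop. 12; §2.2 Prop. 14; §2.4 Prop. 15;
  §2.7 Prop. 17; §4.2 Lemme 2; §5.2 (iv); §5.4 proof of Prop. 21.
-/

noncomputable section

open scoped Classical NumberField
open IsDedekindDomain Field Matrix NumberField
open WeierstrassCurve Literature.NumberTheory.EllipticCurves Literature.NumberTheory.GaloisRepresentations
  Literature.NumberTheory.GaloisRepresentations.Serre1972 Rat.HeightOneSpectrum
  Literature.NumberTheory.EllipticCurves.Rank1Residual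

namespace Summit.BirchSwinnertonDyer.Rank1Residual.GaloisImage

variable (W : WeierstrassCurve ℚ) [W.IsElliptic] [W.IsGloballyMinimal] (p : ℕ) [hp : Fact p.Prime]

/-! ### §1.11 Prop. 12 at a good supersingular prime, frame-free -/

/-- **Serre 1972, §1.11 Prop. 12 at a good supersingular `p ≠ 2`, frame-free.**  If `E = W/ℚ`
(global minimal model) has good supersingular reduction at `p` (`GoodSS W p`), then for EVERY prime
`𝔏` of `\bar ℤ` above `p` the image of the inertia group `I_𝔏` in `Aut(E[p])` is cyclic of order
`p² - 1` (tame inertia acts through the fundamental character of level `2`).  The supersingular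
branch of the tree's `WeierstrassCurve.inertia_shape_of_isSemistable`, with `IsSemistable` replaced
by the local hypothesis: `isCyclic_and_card_inertia_map_of_dvd_frobeniusTrace` at the place's prime
(tame Kummer input `exists_mem_inertia_smul_eq_mul_of_pow_eq`), moved to `𝔏` by conjugation
(`isCyclic_and_card_map_inertia_smul`). [cite: Serre1972, §1.11 Prop. 12 c)] -/
theorem isCyclic_and_card_inertia_map_of_goodSS (hp2 : p ≠ 2) (hss : GoodSS W p)
    {v : HeightOneSpectrum (𝓞 ℚ)} (hv : (primesEquiv v : ℕ) = p)
    {𝔏 : Ideal (absIntegers (𝓞 ℚ) ℚ)} (h𝔏 : 𝔏 ∈ v.primesAbove) :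
    IsCyclic ((𝔏.inertia (absoluteGaloisGroup ℚ)).map (galoisRepTorsion W p)) ∧
      Nat.card ((𝔏.inertia (absoluteGaloisGroup ℚ)).map (galoisRepTorsion W p)) = p ^ 2 - 1 := by
  have hpp : p.Prime := hp.out
  have hΔ := W.not_dvd_minimalDiscriminantInt_of_hasGoodReductionAtPrime' p hss.1
  obtain ⟨𝔓, hmem, h𝔓⟩ := exists_ideal_placeOver p hv
  obtain ⟨g, hg⟩ :=
    HeightOneSpectrum.exists_smul_eq_of_mem_primesAbove_holds (K := ℚ) (v := v) h𝔓 h𝔏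
  rw [← hg]
  have hm : 0 < p ^ 2 - 1 := by
    have : 4 ≤ p ^ 2 := by nlinarith [hpp.two_le]
    omega
  exact isCyclic_and_card_map_inertia_smul (galoisRepTorsion W p) g 𝔓
    (isCyclic_and_card_inertia_map_of_dvd_frobeniusTrace p hΔ hss.2 hp2 hmem
      (fun π ζ hπ hζ ↦ exists_mem_inertia_smul_eq_mul_of_pow_eq p hm hv h𝔓 hπ hζ))

omit [W.IsGloballyMinimal] in
/-- **Per-place form of Serre's (ii)**: if `p ∤ #ρ̄_{E,p}(Γ_ℚ)`, then `ρ̄_{E,p}` kills the inertia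
group of every prime `𝔓` of `\bar ℤ` above a place `v ∤ p` at which `E` has good OR multiplicative
reduction — at good `v` the module `E[p]` is unramified (Silverman VII.4.1,
`galoisRepTorsion_eq_one_of_mem_inertia`), at multiplicative `v` the inertia acts unipotently
(Tate curve, `smul_smul_sub_eq_of_mem_inertia_geomPoints`), through an element of order dividing `p`,
hence trivially.  (The tree's `galoisRepTorsion_eq_one_of_mem_inertia_of_isSemistable` is the same
argument under GLOBAL semistability; here only the place `v` matters.)
[cite: Serre1972, §5.4 Prop. 21 (ii) and its proof] -/
theorem galoisRepTorsion_eq_one_of_mem_inertia_of_good_or_mult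
    (hG : ¬ p ∣ Nat.card (galoisRepTorsion W p).range)
    {v : HeightOneSpectrum (𝓞 ℚ)} (hpv : (p : 𝓞 ℚ) ∉ v.asIdeal)
    (hred : W.HasGoodReductionAt v ∨ W.HasMultiplicativeReductionAt v)
    {𝔓 : Ideal (absIntegers (𝓞 ℚ) ℚ)} (h𝔓 : 𝔓 ∈ v.primesAbove)
    {τ : absoluteGaloisGroup ℚ} (hτ : τ ∈ 𝔓.inertia (absoluteGaloisGroup ℚ)) :
    galoisRepTorsion W p τ = 1 := by
  have hpp : p.Prime := hp.out
  rcases hred with hgood | hmult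
  · exact W.galoisRepTorsion_eq_one_of_mem_inertia hgood (by rwa [Int.cast_natCast]) h𝔓 hτ
  · have hunip : ∀ Q : geomTorsion W p, τ • (τ • Q - Q) = τ • Q - Q := fun Q ↦ by
      have hQ : p ^ 1 • (Q : geomPoints W) = 0 := by
        rw [pow_one]
        have h := (mem_torsionPoints_iff _ _ (Q : geomPoints W)).mp Q.2
        rwa [natCast_zsmul] at h
      have h := W.smul_smul_sub_eq_of_mem_inertia_geomPoints hmult hpp hpv le_rfl h𝔓 hτ hQ
      exact Subtype.ext (by
        simpa only [AddSubgroup.torsionBy.coe_smul, AddSubgroupClass.coe_sub] using h)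
    have hpow := galoisRepTorsion_pow_prime_eq_one_of_unipotent W p hunip
    have h1 : orderOf (galoisRepTorsion W p τ) ∣ p := orderOf_dvd_of_pow_eq_one hpow
    have h2 : orderOf (galoisRepTorsion W p τ) ∣ Nat.card (galoisRepTorsion W p).range :=
      Subgroup.orderOf_dvd_natCard _ ⟨τ, rfl⟩
    have hcop : Nat.Coprime p (Nat.card (galoisRepTorsion W p).range) :=
      (Nat.Prime.coprime_iff_not_dvd hpp).mpr hG
    exact orderOf_eq_one_iff.mp ((Nat.Coprime.coprime_dvd_left h1 hcop).eq_one_of_dvd h2)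

/-! ### In a frame: the inertia image is a non-split Cartan subgroup `kˣ ≤ G` -/

section Frame

variable (Φ : Multiplicative (AddAut (geomTorsion W p)) ≃* GL (Fin 2) (ZMod p))
  (e : geomTorsion W p ≃+ (Fin 2 → ZMod p))
  (he : ∀ (g : Multiplicative (AddAut (geomTorsion W p))) (x : geomTorsion W p),
    e (Multiplicative.toAdd g x) =
      ((Φ g : GL (Fin 2) (ZMod p)) : Matrix (Fin 2) (Fin 2) (ZMod p)) *ᵥ e x)

/-- **Prop. 12 c) through a frame: the inertia image at a good supersingular `p ≠ 2` IS a
non-split Cartan subgroup.**  For every prime `𝔏 ∣ p` of `\bar ℤ` there is a subalgebra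
`k ⊆ M₂(𝔽_p)` which is a field of degree `2` with `Φ(ρ̄(I_𝔏)) = kˣ`
(`isCyclic_and_card_inertia_map_of_goodSS` + `exists_isField_eq_unitGroup_map_of_isCyclic`).
[cite: Serre1972, §1.11 Prop. 12 c)] -/
theorem exists_unitGroup_eq_inertia_image_of_goodSS (hp2 : p ≠ 2) (hss : GoodSS W p)
    {v : HeightOneSpectrum (𝓞 ℚ)} (hv : (primesEquiv v : ℕ) = p)
    {𝔏 : Ideal (absIntegers (𝓞 ℚ) ℚ)} (h𝔏 : 𝔏 ∈ v.primesAbove) :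
    ∃ k : Subalgebra (ZMod p) (Matrix (Fin 2) (Fin 2) (ZMod p)), IsField k ∧
      Module.finrank (ZMod p) k = 2 ∧
      ((𝔏.inertia (absoluteGaloisGroup ℚ)).map (galoisRepTorsion W p)).map Φ.toMonoidHom =
        unitGroup k := by
  obtain ⟨hcyc, hcard⟩ := isCyclic_and_card_inertia_map_of_goodSS W p hp2 hss hv h𝔏
  exact exists_isField_eq_unitGroup_map_of_isCyclic Φ hcyc hcard

/-- **The image `G = Φ(ρ̄_{E,p}(Γ_ℚ))` at a good supersingular `p ≠ 2` contains a non-split Cartan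
subgroup `kˣ`** (the inertia image at any prime above `p`). [cite: Serre1972, §1.11 Prop. 12 c)] -/
theorem exists_unitGroup_le_image_of_goodSS (hp2 : p ≠ 2) (hss : GoodSS W p) :
    ∃ k : Subalgebra (ZMod p) (Matrix (Fin 2) (Fin 2) (ZMod p)), IsField k ∧
      Module.finrank (ZMod p) k = 2 ∧
      unitGroup k ≤ (galoisRepTorsion W p).range.map Φ.toMonoidHom := by
  have hpp : p.Prime := hp.out
  obtain ⟨v, hv⟩ : ∃ v : HeightOneSpectrum (𝓞 ℚ), (primesEquiv v : ℕ) = p :=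
    ⟨primesEquiv.symm ⟨p, hpp⟩, by rw [Equiv.apply_symm_apply]⟩
  obtain ⟨𝔏, h𝔏⟩ := v.primesAbove_nonempty
  obtain ⟨k, hk, h2, hkI⟩ := exists_unitGroup_eq_inertia_image_of_goodSS W p Φ hp2 hss hv h𝔏
  refine ⟨k, hk, h2, ?_⟩
  rw [← hkI]
  exact Subgroup.map_mono (fun x ⟨τ, _, hτ⟩ ↦ ⟨τ, hτ⟩)

/-- **No split Cartan normaliser at a good supersingular `p ≠ 2`** — for EVERY elliptic curve over
`ℚ`, whatever its image: if `G ≤ N(P (* 0; 0 *) P⁻¹)` then the inertia non-split Cartan subgroup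
`kˣ ≤ G` normalises the split Cartan subgroup, so Prop. 14 (`prop14_unitGroup`, `p ≥ 3`) forces
`kˣ = P (* 0; 0 *) P⁻¹` — a non-split Cartan subgroup is not a split one (`unitGroup_ne_splitCartan`).
So the image types `pNs`/`pCs` never occur at a supersingular `p`, and the published split-Cartan
classification (Bilu–Parent–Rebolledo 2013, BDMTV 2019) is vacuous there.  The exact mirror of x9's
`not_le_normalizer_unitGroup_of_goodOrd`. [cite: Serre1972, §2.2 Prop. 14] -/
theorem not_le_normalizer_splitCartan_of_goodSS (hp2 : p ≠ 2) (hss : GoodSS W p)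
    (P : GL (Fin 2) (ZMod p)) :
    ¬ (galoisRepTorsion W p).range.map Φ.toMonoidHom ≤
        Subgroup.normalizer (splitCartan P : Set (GL (Fin 2) (ZMod p))) := by
  intro hle
  have hpp : p.Prime := hp.out
  have hp3 : 3 ≤ p := by have := hpp.two_le; omega
  obtain ⟨k, hk, h2, hkG⟩ := exists_unitGroup_le_image_of_goodSS W p Φ hp2 hss
  have heq : unitGroup k = splitCartan P :=
    prop14_unitGroup (splitCartan_mem_cartanSubgroups P) hp3 hk h2 (hkG.trans hle)
  exact unitGroup_ne_splitCartan hp2 hk P heq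

include he in
/-- **`GoodSS ∧ ¬Surj ⟹ p ∤ #G`** (`E[p]` irreducible by Prop. 12, and Prop. 15:
`not_dvd_card_of_not_hasSurjectiveModNGaloisRep`). [cite: Serre1972, §2.4 Prop. 15] -/
theorem not_dvd_card_image_of_goodSS_of_not_surj (hp2 : p ≠ 2) (hss : GoodSS W p)
    (hns : ¬ Surj W p) :
    ¬ p ∣ Nat.card ((galoisRepTorsion W p).range.map Φ.toMonoidHom) :=
  not_dvd_card_of_not_hasSurjectiveModNGaloisRep W p Φ e he
    (hasIrreducibleModPGaloisRep_of_dvd_frobeniusTrace W p hp2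
      (W.not_dvd_minimalDiscriminantInt_of_hasGoodReductionAtPrime' p hss.1) hss.2) hns

include he in
/-- **MAIN — at a good supersingular `p ≠ 2` with `ρ̄_{E,p}` not onto, the image normalises the
inertia non-split Cartan subgroup: `kˣ ≤ G ≤ N(kˣ)`, `G ⊄ kˣ`** (`k ⊆ M₂(𝔽_p)` a field of degree
`2`, `kˣ = Φ(ρ̄(I_𝔏))`).  Serre §5.4 / §4.2 b) at an unramified supersingular prime: `G ⊇ kˣ`
(Prop. 12); Prop. 17 for a NON-SPLIT Cartan subgroup (any odd `p`, no `p ≠ 5` clause: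
`borel_or_normalizer_of_unitGroup_le`) leaves `G = GL₂` (excluded: `¬Surj`), Borel (excluded:
`E[p]` is irreducible, Prop. 12), `G ⊆ C` (excluded by complex conjugation, §5.2 (iv)) or `G ⊆ N(C)`, `G ⊄ C` for a
Cartan subgroup `C`; as `kˣ ≤ G ≤ N(C)`, Prop. 14 (`prop14_unitGroup`, `p ≥ 3`) gives `C = kˣ`.
In words: `E` is a non-cuspidal `ℚ`-point of `X_ns⁺(p)` (and `ρ̄_{E,p}` is dihedral of non-split
type).  STRUCTURE ONLY — no bound on `p` is claimed (Serre uniformity).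
[cite: Serre1972, §1.11 Prop. 12, §2.2 Prop. 14, §2.7 Prop. 17, §5.2 (iv)] -/
theorem exists_le_normalizer_unitGroup_of_goodSS_of_not_surj (hp2 : p ≠ 2) (hss : GoodSS W p)
    (hns : ¬ Surj W p) :
    ∃ k : Subalgebra (ZMod p) (Matrix (Fin 2) (Fin 2) (ZMod p)), IsField k ∧
      Module.finrank (ZMod p) k = 2 ∧
      unitGroup k ≤ (galoisRepTorsion W p).range.map Φ.toMonoidHom ∧
      (galoisRepTorsion W p).range.map Φ.toMonoidHom ≤
          Subgroup.normalizer (unitGroup k : Set (GL (Fin 2) (ZMod p))) ∧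
        ¬ (galoisRepTorsion W p).range.map Φ.toMonoidHom ≤ unitGroup k := by
  have hpp : p.Prime := hp.out
  have hp3 : 3 ≤ p := by have := hpp.two_le; omega
  set G : Subgroup (GL (Fin 2) (ZMod p)) := (galoisRepTorsion W p).range.map Φ.toMonoidHom
    with hGdef
  have hGtop : G ≠ ⊤ := fun h ↦ hns ((map_range_galoisRepTorsion_eq_top_iff W p Φ).mp h)
  -- `E[p]` is irreducible (Serre Prop. 12; the term of `Partition.irr_of_goodSS` / `ClassX7.irr`)
  have hirr : Irr W p := hasIrreducibleModPGaloisRep_of_dvd_frobeniusTrace W p hp2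
    (W.not_dvd_minimalDiscriminantInt_of_hasGoodReductionAtPrime' p hss.1) hss.2
  obtain ⟨k, hk, h2, hkG⟩ := exists_unitGroup_le_image_of_goodSS W p Φ hp2 hss
  obtain ⟨c, hcG, hcc, hcdet⟩ := exists_conj_mem_map_range W p Φ e he
  rcases borel_or_normalizer_of_unitGroup_le G hp2 hk h2 hkG hGtop hcG hcc hcdet with
    ⟨w, hw, hB⟩ | ⟨C, hC, hGN, hGC⟩
  · exact absurd hB (not_le_eigenvectorStabilizer_of_hasIrreducibleModPGaloisRep W p Φ e he hirr hw)
  · have hCeq : unitGroup k = C := prop14_unitGroup hC hp3 hk h2 (hkG.trans hGN)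
    subst hCeq
    exact ⟨k, hk, h2, hkG, hGN, hGC⟩

include he in
/-- **The row's literal shape (team n1011, OWNERS T-O8c): `GoodSS W p → 5 ≤ p → ¬Surj W p →`
image `≤ N(C_ns)`** — the case `5 ≤ p` of `exists_le_normalizer_unitGroup_of_goodSS_of_not_surj`
(which needs only `p ≠ 2`). [cite: Serre1972, §2.7 Prop. 17] -/
theorem exists_le_normalizer_unitGroup_of_goodSS_of_five_le (h5 : 5 ≤ p) (hss : GoodSS W p)
    (hns : ¬ Surj W p) :
    ∃ k : Subalgebra (ZMod p) (Matrix (Fin 2) (Fin 2) (ZMod p)), IsField k ∧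
      Module.finrank (ZMod p) k = 2 ∧
      unitGroup k ≤ (galoisRepTorsion W p).range.map Φ.toMonoidHom ∧
      (galoisRepTorsion W p).range.map Φ.toMonoidHom ≤
          Subgroup.normalizer (unitGroup k : Set (GL (Fin 2) (ZMod p))) ∧
        ¬ (galoisRepTorsion W p).range.map Φ.toMonoidHom ≤ unitGroup k :=
  exists_le_normalizer_unitGroup_of_goodSS_of_not_surj W p Φ e he (by omega) hss hns

include he in
/-- **Dichotomy at a good supersingular `p ≠ 2`: `ρ̄_{E,p}` is onto, or its image normalises (and
contains, and is not inside) a non-split Cartan subgroup.**  In particular the image is never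
Borel, never in a split-Cartan normaliser (`not_le_normalizer_splitCartan_of_goodSS`) and never of
exceptional projective type `𝔄₄/𝔖₄/𝔄₅` unless inside `N(kˣ)`. [cite: Serre1972, §2.7 Prop. 17] -/
theorem surj_or_exists_le_normalizer_unitGroup_of_goodSS (hp2 : p ≠ 2) (hss : GoodSS W p) :
    Surj W p ∨
      ∃ k : Subalgebra (ZMod p) (Matrix (Fin 2) (Fin 2) (ZMod p)), IsField k ∧
        Module.finrank (ZMod p) k = 2 ∧
        unitGroup k ≤ (galoisRepTorsion W p).range.map Φ.toMonoidHom ∧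
        (galoisRepTorsion W p).range.map Φ.toMonoidHom ≤
            Subgroup.normalizer (unitGroup k : Set (GL (Fin 2) (ZMod p))) ∧
          ¬ (galoisRepTorsion W p).range.map Φ.toMonoidHom ≤ unitGroup k := by
  by_cases hns : Surj W p
  · exact Or.inl hns
  · exact Or.inr (exists_le_normalizer_unitGroup_of_goodSS_of_not_surj W p Φ e he hp2 hss hns)

include he in
/-- **The quadratic character of a non-surjective good supersingular prime `p ≠ 2`.**  With `kˣ`
the non-split Cartan subgroup of `exists_le_normalizer_unitGroup_of_goodSS_of_not_surj`, the
subgroup `U = ρ̄⁻¹(Φ⁻¹(kˣ)) ≤ Γ_ℚ` ("`Gal(ℚ̄/K'_p)`", Serre §4.2 c)) is open of index `2` —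
`ρ̄_{E,p}` is induced from the quadratic field `M` of `U` — and `U` contains the inertia group of
every prime of `\bar ℤ` above `p` (the inertia image there IS a non-split Cartan subgroup inside
`N(kˣ)`, hence equal to `kˣ` by Prop. 14: `M` is UNRAMIFIED AT `p`) and above every place
`v ∤ p` of good or multiplicative reduction (`galoisRepTorsion_eq_one_of_mem_inertia_of_good_or_mult`,
`p ∤ #G`).  So `M` ramifies only at the ADDITIVE primes of `E`; for semistable `E` no such `M`
exists (Minkowski) — Serre's Prop. 21 / class X6.  Tree inputs: `index_comap_cartan_eq_two`,
`isOpen_comap_cartan`, `mem_comap_cartan_iff`. [cite: Serre1972, §4.2 c), Lemme 2; §2.2 Prop. 14;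
§5.4 proof of Prop. 21] -/
theorem exists_index_two_subgroup_of_goodSS_of_not_surj (hp2 : p ≠ 2) (hss : GoodSS W p)
    (hns : ¬ Surj W p) :
    ∃ k : Subalgebra (ZMod p) (Matrix (Fin 2) (Fin 2) (ZMod p)), IsField k ∧
      Module.finrank (ZMod p) k = 2 ∧
      (galoisRepTorsion W p).range.map Φ.toMonoidHom ≤
          Subgroup.normalizer (unitGroup k : Set (GL (Fin 2) (ZMod p))) ∧
      ¬ (galoisRepTorsion W p).range.map Φ.toMonoidHom ≤ unitGroup k ∧
      IsOpen ((((unitGroup k).comap Φ.toMonoidHom).comap (galoisRepTorsion W p) :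
          Subgroup (absoluteGaloisGroup ℚ)) : Set (absoluteGaloisGroup ℚ)) ∧
      (((unitGroup k).comap Φ.toMonoidHom).comap (galoisRepTorsion W p)).index = 2 ∧
      (∀ v : HeightOneSpectrum (𝓞 ℚ),
        ((p : 𝓞 ℚ) ∈ v.asIdeal ∨ W.HasGoodReductionAt v ∨ W.HasMultiplicativeReductionAt v) →
        ∀ 𝔔 ∈ v.primesAbove,
          𝔔.inertia (absoluteGaloisGroup ℚ) ≤
            ((unitGroup k).comap Φ.toMonoidHom).comap (galoisRepTorsion W p)) := by
  have hpp : p.Prime := hp.out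
  have hp3 : 3 ≤ p := by have := hpp.two_le; omega
  set ρ := galoisRepTorsion W p with hρ
  set G : Subgroup (GL (Fin 2) (ZMod p)) := ρ.range.map Φ.toMonoidHom with hGdef
  obtain ⟨k, hk, h2, -, hGN, hGC⟩ :=
    exists_le_normalizer_unitGroup_of_goodSS_of_not_surj W p Φ e he hp2 hss hns
  have hC : unitGroup k ∈ cartanSubgroups (ZMod p) := unitGroup_mem_cartanSubgroups hk h2
  have hCp : (∃ P : GL (Fin 2) (ZMod p), unitGroup k = splitCartan P) → p ≠ 2 := fun _ ↦ hp2
  have hpG : ¬ p ∣ Nat.card G := not_dvd_card_image_of_goodSS_of_not_surj W p Φ e he hp2 hss hns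
  have hpGr : ¬ p ∣ Nat.card ρ.range := by rwa [← card_map_range_galoisRepTorsion W p Φ]
  refine ⟨k, hk, h2, hGN, hGC, isOpen_comap_cartan W p Φ, index_comap_cartan_eq_two W p Φ hC hCp hGN hGC,
    ?_⟩
  intro v hv 𝔔 h𝔔 τ hτ
  rw [mem_comap_cartan_iff]
  by_cases hpv : (p : 𝓞 ℚ) ∈ v.asIdeal
  · -- at `p`: the inertia image is a non-split Cartan subgroup inside `N(kˣ)`, hence `= kˣ`
    have hv' : (primesEquiv v : ℕ) = p := primesEquiv_eq_of_natCast_mem hpp hpv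
    obtain ⟨k', hk', h2', hk'I⟩ :=
      exists_unitGroup_eq_inertia_image_of_goodSS W p Φ hp2 hss hv' h𝔔
    have hHle : ((𝔔.inertia (absoluteGaloisGroup ℚ)).map ρ).map Φ.toMonoidHom ≤ G :=
      Subgroup.map_mono (fun x ⟨σ, _, hσ⟩ ↦ ⟨σ, hσ⟩)
    have hk'N : unitGroup k' ≤ Subgroup.normalizer (unitGroup k : Set (GL (Fin 2) (ZMod p))) := by
      rw [← hk'I]
      exact hHle.trans hGN
    have hkk : unitGroup k' = unitGroup k := prop14_unitGroup hC hp3 hk' h2' hk'N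
    have hmem : Φ (ρ τ) ∈ ((𝔔.inertia (absoluteGaloisGroup ℚ)).map ρ).map Φ.toMonoidHom :=
      ⟨ρ τ, ⟨τ, hτ, rfl⟩, rfl⟩
    rw [hk'I, hkk] at hmem
    exact hmem
  · -- away from `p`: (ii) at a good or multiplicative place
    have hred : W.HasGoodReductionAt v ∨ W.HasMultiplicativeReductionAt v := by
      rcases hv with h | h
      · exact absurd h hpv
      · exact h
    rw [galoisRepTorsion_eq_one_of_mem_inertia_of_good_or_mult W p hpGr hpv hred h𝔔 hτ, map_one]
    exact (unitGroup k).one_mem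

end Frame

/-! ### Frame-free summary -/

/-- **Frame-free summary.**  Let `E = W/ℚ` (global minimal model) have good supersingular
reduction at a prime `p ≠ 2` with `ρ̄_{E,p}` not surjective.  Then there is an `𝔽_p`-frame
`(e, Φ)` of `E[p]` (frames exist: `exists_frame_galoisRepTorsion_rat`) and a subalgebra
`k ⊆ M₂(𝔽_p)` which is a field of degree `2` such that `kˣ ≤ Φ(ρ̄(Γ_ℚ)) ≤ N(kˣ)` and
`Φ(ρ̄(Γ_ℚ)) ⊄ kˣ`: the image of `ρ̄_{E,p}` is contained in the normaliser of a non-split Cartan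
subgroup of `GL₂(𝔽_p)`, contains the Cartan subgroup, and meets the non-trivial coset.
[cite: Serre1972, §1.11 Prop. 12, §2.7 Prop. 17, §2.2 Prop. 14] -/
theorem exists_frame_le_normalizer_unitGroup_of_goodSS_of_not_surj (hp2 : p ≠ 2)
    (hss : GoodSS W p) (hns : ¬ Surj W p) :
    ∃ (e : geomTorsion W p ≃+ (Fin 2 → ZMod p))
      (Φ : Multiplicative (AddAut (geomTorsion W p)) ≃* GL (Fin 2) (ZMod p)),
      (∀ (g : Multiplicative (AddAut (geomTorsion W p))) (x : geomTorsion W p),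
        e (Multiplicative.toAdd g x) =
          ((Φ g : GL (Fin 2) (ZMod p)) : Matrix (Fin 2) (Fin 2) (ZMod p)) *ᵥ e x) ∧
      ∃ k : Subalgebra (ZMod p) (Matrix (Fin 2) (Fin 2) (ZMod p)), IsField k ∧
        Module.finrank (ZMod p) k = 2 ∧
        unitGroup k ≤ (galoisRepTorsion W p).range.map Φ.toMonoidHom ∧
        (galoisRepTorsion W p).range.map Φ.toMonoidHom ≤
            Subgroup.normalizer (unitGroup k : Set (GL (Fin 2) (ZMod p))) ∧
          ¬ (galoisRepTorsion W p).range.map Φ.toMonoidHom ≤ unitGroup k := by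
  obtain ⟨e, Φ, he, -⟩ := exists_frame_galoisRepTorsion_rat W p
  exact ⟨e, Φ, he, exists_le_normalizer_unitGroup_of_goodSS_of_not_surj W p Φ e he hp2 hss hns⟩

end Summit.BirchSwinnertonDyer.Rank1Residual.GaloisImage

end
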